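import Mathlib
import Summits.NavierStokesRegularity.NavierStokesRegularity.Theorems.EulerZoomLiouvillePowerGaugeEulerLiouvilleNeedleStagnationKinematics
import Literature.Analysis.FluidPDE.SelfSimilarCollapseAnsatz
import HarnessLib

/-!
# Crux `EulerZoomLiouville.PowerGaugeEulerLiouville` (stmt-NavierStokesRegularity-19832): THE STAGNANT PARTICLE (plate t60-SPB of nsreg-p2 ROUND-55)

Width/portrait piece for THE ONE STATEMENT `stub_selfSimilarC2Needle` (LEAD skeleton `Cruxes/PowerGaugeEulerLiouville/Lines/birth.lean`
v112, ns-typeII-p2 g16), `--supports stmt-NavierStokesRegularity-19832 --as helper`.  Texts = nsreg-p2 g45's `r55/Sketch55.lean`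
(sha16 556b38828be01d7e, namespace `NsregP2.R55.Pinch`) §S, VERBATIM (this file stays definition-free).

Setting: a `C²` self-similar Euler profile `(V, P)` with `γ = 1/(2+ρ)`, centre `0` (`IsSelfSimilarEulerProfile γ 0 V P`), `W = γy + V`,
and the Literature's collapse ansatz `u(τ, x) = (−τ)^{γ−1} V((−τ)^{−γ} x)` (`selfSimilarCollapse γ 0 V`).

CONTENTS (all PROVED, std axioms; proofs = Sketch55's, by nsreg-p2 g45):
* **SPB** `stagnantParticleBlowup (hρ : −1 < ρ) V : <NsregP2.R55.Pinch.StagnantParticleBlowup ρ V unfolded>` — the physical particle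
  of a non-zero stagnant label `y⋆` (`W(y⋆) = 0`) runs into the singular point with speed `|u(τ, (−τ)^γ y⋆)| = γ|y⋆|(−τ)^{γ−1} → ∞`
  as `τ → 0⁻`;
* `fderiv_curl_eq_self_of_stagnant` — at a zero of `W` the strain FIXES the vorticity (the tree's knot identity
  `Stagnation.fderiv_apply_curl_of_stagnation`, R41, in the Seed55 hypothesis form);
* `not_integrableOn_strain_of_stagnant` — a VORTICAL stagnant label has infinite accumulated strain;
* `selfSimilarTransport_eq_zero_of_stagnant` — the stagnant label is a constant similarity trajectory.
By-name check: `example {ρ} (hρ : -1 < ρ) (V) : NsregP2.R55.Pinch.StagnantParticleBlowup ρ V := StagnantParticle.stagnantParticleBlowup hρ V`.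

HONEST FRAMING: kinematics of HYPOTHETICAL profiles; not a claim that knots (zeros of `W`) exist (R55 B2); nothing here bears on the
crux E (19832, OPEN) or on NS regularity; «hard core evaded: NO».
[nsreg-p2 R55 §S t60-SPB; folklore; cite: ConstantinIgnatovaVicol2026Putative, §3.4.1]
-/

noncomputable section

set_option linter.dupNamespace false

open Filter Topology MeasureTheory Set Metric Function InnerProductSpace
open scoped RealInnerProductSpace ENNReal NNReal

namespace Summit.NavierStokesRegularity.NavierStokesRegularity.Theorems.PowerGaugeEulerLiouville.StagnantParticle

open Literature.Analysis Literature.Analysis.FluidPDE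
open Summit.NavierStokesRegularity.NavierStokesRegularity.Theorems.PowerGaugeEulerLiouville

/-- **SPB PROVED — THE STAGNANT PARTICLE BLOW-UP** (text = `NsregP2.R55.Pinch.StagnantParticleBlowup ρ V`, Sketch55 556b38828be01d7e =
Seed55 VERBATIM): the physical particle of a non-zero stagnant label `y⋆` (`γy⋆ + V(y⋆) = 0`) runs into the singular point with speed
`|u(τ, (−τ)^γ y⋆)| = γ|y⋆|(−τ)^{γ−1} → ∞` as `τ → 0⁻` (`0 < γ = 1/(2+ρ) < 1`, i.e. `ρ > −1`), in the Literature's `selfSimilarCollapse`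
ansatz. [nsreg-p2 R55 §S SPB; folklore] -/
theorem stagnantParticleBlowup {ρ : ℝ} (hρ : -1 < ρ) (V : EuclideanSpace ℝ (Fin 3) → EuclideanSpace ℝ (Fin 3)) :
    ∀ P : EuclideanSpace ℝ (Fin 3) → ℝ, IsSelfSimilarEulerProfile (1 / (2 + ρ)) 0 V P →
    ∀ ystar : EuclideanSpace ℝ (Fin 3), (1 / (2 + ρ)) • ystar + V ystar = 0 → ystar ≠ 0 →
      Tendsto (fun τ : ℝ => ‖selfSimilarCollapse (1 / (2 + ρ)) 0 V τ ((-τ) ^ (1 / (2 + ρ)) • ystar)‖) (𝓝[<] 0) atTop := by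
  intro P _hP ystar hW hy
  set γ : ℝ := 1 / (2 + ρ) with hγ
  have h2ρ : 0 < 2 + ρ := by linarith
  have hγ0 : 0 < γ := by rw [hγ]; exact div_pos one_pos h2ρ
  have hγ1 : γ < 1 := by rw [hγ, div_lt_one h2ρ]; linarith
  have hVy : V ystar = -(γ • ystar) := eq_neg_of_add_eq_zero_right hW
  have hy' : 0 < γ * ‖ystar‖ := mul_pos hγ0 (norm_pos_iff.2 hy)
  have key : ∀ τ : ℝ, τ < 0 →
      ‖selfSimilarCollapse γ 0 V τ ((-τ) ^ γ • ystar)‖ = (-τ) ^ (γ - 1) * (γ * ‖ystar‖) := by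
    intro τ hτ
    have hτ' : 0 < -τ := neg_pos.2 hτ
    rw [selfSimilarCollapse_apply, zero_sub, smul_smul, ← Real.rpow_add hτ', neg_add_cancel, Real.rpow_zero, one_smul,
      hVy, norm_smul, norm_neg, norm_smul, Real.norm_eq_abs, Real.norm_eq_abs,
      abs_of_pos (Real.rpow_pos_of_pos hτ' _), abs_of_pos hγ0]
  have hneg : Tendsto (fun τ : ℝ => -τ) (𝓝[<] (0 : ℝ)) (𝓝[>] (0 : ℝ)) := by
    simpa using (tendsto_neg_nhdsLT (a := (0 : ℝ)))
  have hpow : Tendsto (fun τ : ℝ => (-τ) ^ (γ - 1)) (𝓝[<] (0 : ℝ)) atTop :=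
    (tendsto_rpow_neg_nhdsGT_zero (by linarith : γ - 1 < 0)).comp hneg
  have hlim : Tendsto (fun τ : ℝ => (-τ) ^ (γ - 1) * (γ * ‖ystar‖)) (𝓝[<] (0 : ℝ)) atTop :=
    hpow.atTop_mul_const hy'
  refine hlim.congr' ?_
  filter_upwards [self_mem_nhdsWithin] with τ hτ
  exact (key τ hτ).symm

/-- **At a zero of `W = γy + V` the strain FIXES the vorticity** — the tree's knot identity `Stagnation.fderiv_apply_curl_of_stagnation`
(R41, `…NeedleStagnationKinematics`) in the Seed55 hypothesis form `γ • y⋆ + V y⋆ = 0`, BY NAME. [nsreg-p2 R55 §S; folklore] -/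
theorem fderiv_curl_eq_self_of_stagnant {γ : ℝ} {V : EuclideanSpace ℝ (Fin 3) → EuclideanSpace ℝ (Fin 3)}
    {P : EuclideanSpace ℝ (Fin 3) → ℝ} (hP : IsSelfSimilarEulerProfile γ 0 V P)
    {ystar : EuclideanSpace ℝ (Fin 3)} (hW : γ • ystar + V ystar = 0) :
    fderiv ℝ V ystar (curl V ystar) = curl V ystar := by
  have hz : selfSimilarTransport γ 0 V ystar = 0 := by rw [selfSimilarTransport_apply, sub_zero]; exact hW
  exact Stagnation.fderiv_apply_curl_of_stagnation hP hz

/-- **A VORTICAL stagnant label has INFINITE accumulated strain**: if `γy⋆ + V(y⋆) = 0` and `curl V (y⋆) ≠ 0` then `DV(y⋆) ≠ 0`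
(it fixes the vorticity), so the constant `‖DV(y⋆)‖ > 0` is not integrable on `[0, ∞)` (Seed55 statement; proof on top of the
tree's knot identity). [nsreg-p2 R55 §S; folklore] -/
theorem not_integrableOn_strain_of_stagnant {γ : ℝ} {V : EuclideanSpace ℝ (Fin 3) → EuclideanSpace ℝ (Fin 3)}
    {P : EuclideanSpace ℝ (Fin 3) → ℝ} (hP : IsSelfSimilarEulerProfile γ 0 V P)
    {ystar : EuclideanSpace ℝ (Fin 3)} (hW : γ • ystar + V ystar = 0) (hΩ : curl V ystar ≠ 0) :
    ¬ IntegrableOn (fun _ : ℝ => ‖fderiv ℝ V ystar‖) (Ici (0 : ℝ)) := by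
  have hfix := fderiv_curl_eq_self_of_stagnant hP hW
  have hpos : 0 < ‖fderiv ℝ V ystar‖ := by
    by_contra hle
    push Not at hle
    have h0 : fderiv ℝ V ystar = 0 := norm_le_zero_iff.1 hle
    exact hΩ (by rw [← hfix, h0]; simp)
  intro hint
  have := (integrableOn_const_iff (C := ‖fderiv ℝ V ystar‖) (s := Ici (0 : ℝ)) (μ := volume)).1 hint
  rcases this with h | h
  · rw [enorm_eq_zero] at h
    exact hpos.ne' h
  · simp at h

/-- **The stagnant label is a CONSTANT similarity trajectory of the profile's own flow field: `W(y⋆) = 0`.**  With the knot identity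
this puts `y⋆` (if vortical) in R54's exceptional set `𝒩` BY NAME (infinite forward strain). [nsreg-p2 R55 §S; folklore] -/
theorem selfSimilarTransport_eq_zero_of_stagnant {γ : ℝ} {V : EuclideanSpace ℝ (Fin 3) → EuclideanSpace ℝ (Fin 3)}
    {ystar : EuclideanSpace ℝ (Fin 3)} (hW : γ • ystar + V ystar = 0) :
    selfSimilarTransport γ 0 V ystar = 0 := by
  rw [selfSimilarTransport_apply, sub_zero]; exact hW

end Summit.NavierStokesRegularity.NavierStokesRegularity.Theorems.PowerGaugeEulerLiouville.StagnantParticle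

end
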